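import Mathlib
import HarnessLib
import Literature.MathematicalPhysics.StatisticalMechanics.FluctuationKernelComparison
import Literature.MathematicalPhysics.StatisticalMechanics.StepKernelBoundsTorusFRD

/-!
# Lemma 8.4 (`ℓ = 1`) for the torus data: the inputs of `tayNormLE_fluct_sub_fluct` for the
# [ABKM19] weights and the step kernels `𝒞_{A,k+1}` of a `TorusFRD` package

`FluctuationKernelComparison.tayNormLE_fluct_sub_fluct` bounds
`‖R_{𝒞a}K − R_{𝒞b}K‖_{T, w_{k:k+1}^X}` by `C·ℓ·δ` for two step kernels with `StepKernelBounds`,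
positive multipliers off the zero mode, `δ`-close multipliers, and `StepKernelBounds` for the
dilated kernel `p·𝒞b`.  This file supplies these inputs for the concrete data of [ABKM19]:

* **`AbkmWeightBounds.stepKernelBounds_const_mul`** — `StepKernelBounds` for `p·𝒞q` relative to
  the `q = 0` weights from the multiplier domination `p · Re 𝒞̂q ≤ (1+ρ) ĉ_{k+1}`, `ρ < θ̄`
  (Lemma 7.7 for the dilated kernel; `fourierCoeff_const_mul`, `gradCov_const_mul`);
* **`re_fourierCoeff_pos_of_torusFRD`** — `Re 𝒞̂_{A,k}(κ) > 0` for `κ ≠ 0` (clause (v) lower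
  bounds, every nonzero mode lies in a shell);
* `isUnitSymm_neg`, **`abs_re_fourierCoeff_sub_le_of_torusFRD`** — along an elliptic segment
  `A₀ + tB`, `t ∈ [0,T]`, with `K T ≤ log(1+τ)`:
  `|Re 𝒞̂_{A₀+TB,k}(κ) − Re 𝒞̂_{A₀,k}(κ)| ≤ τ(1+τ) · Re 𝒞̂_{A₀+TB,k}(κ)` for every `κ`
  ([ABKM19] (7.75) in both directions + `abs_sub_le_of_two_sided`);
* **`tayNormLE_fluct_sub_fluct_abkm`** — the estimate for the norm parameters
  `abkmNormParams` (gauge `P.gauge k X`, which kills constants; weights local and dominated by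
  `AbkmWeightBounds`).

Everything is proved; no named fact.

## References
* S. Adams, S. Buchholz, R. Kotecký, S. Müller, arXiv:1910.13564, Lemma 7.7 (7.75), Lemma 8.4,
  Lemma 12.6 [AdamsBuchholzKoteckyMuller2019].
* S. Buchholz, J. Funct. Anal. 275 (2018), Thm 2.4, Thm 4.5 [Buchholz2016].
-/

noncomputable section

namespace Literature.MathematicalPhysics.StatisticalMechanics.GradientRG

open scoped BigOperators
open Real Set Finset MeasureTheory
open Literature.MathematicalPhysics.StatisticalMechanics.GradientFRD
  (fourierCoeff cExt cExt_of_mem IsElliptic IsUnitSymm InShell iterDiff exists_inShell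
    re_fourierCoeff_zero_of_sum_eq_zero)
open Literature.MathematicalPhysics.StatisticalMechanics.TorusPolymer (IsPolymer numBlocks thicken)
open Literature.MathematicalPhysics.QuantumFieldTheory

variable {d M : ℕ} [NeZero M]

/-! ## The dilated kernel `p·𝒞q` -/

/-- `(p𝒞)^(κ) = p · 𝒞̂(κ)`. [cite: Buchholz2016, §2 (2.14)] -/
theorem fourierCoeff_const_mul (p : ℝ) (𝒞 : (Fin d → ZMod M) → ℝ) (κ : Fin d → ZMod M) :
    fourierCoeff (fun x => p * 𝒞 x) κ = (p : ℂ) * fourierCoeff 𝒞 κ := by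
  unfold GradientFRD.fourierCoeff
  rw [Finset.mul_sum]
  refine Finset.sum_congr rfl fun x _ => ?_
  push_cast
  ring

/-- `Re (p𝒞)^(κ) = p · Re 𝒞̂(κ)`. [cite: Buchholz2016, §2 (2.14)] -/
theorem re_fourierCoeff_const_mul (p : ℝ) (𝒞 : (Fin d → ZMod M) → ℝ) (κ : Fin d → ZMod M) :
    (fourierCoeff (fun x => p * 𝒞 x) κ).re = p * (fourierCoeff 𝒞 κ).re := by
  rw [fourierCoeff_const_mul, Complex.re_ofReal_mul]

omit [NeZero M] in
/-- `γ_q(p𝒞) = p · γ_q(𝒞)`. [cite: AdamsBuchholzKoteckyMuller2019, Theorem 6.8 (6.64)] -/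
theorem gradCov_const_mul (p : ℝ) (𝒞 : (Fin d → ZMod M) → ℝ) (q : quadIndex d) :
    gradCov (fun x => p * 𝒞 x) q = p * gradCov 𝒞 q := by
  unfold gradCov; ring

/-- **`StepKernelBounds` for the dilated kernel `p·𝒞q` relative to the `q = 0` weights** from the
multiplier domination `0 ≤ Re 𝒞̂q`, `p · Re 𝒞̂q(κ) ≤ (1+ρ) ĉ_{k+1}(κ)`, `0 ≤ ρ < θ̄`, `p ≥ 0`
(Lemma 7.7 for the dilated kernel; the (w7′) constant is `A𝒫(ρ)`, the `γ`-constant `p·C₂`).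
[cite: AdamsBuchholzKoteckyMuller2019, Lemma 7.7] -/
theorem AbkmWeightBounds.stepKernelBounds_const_mul {L N Mord R n : ℕ}
    {θbar lam μ δ₁ δ₀ A𝒫 : ℝ} {𝒞 : ℕ → (Fin d → ZMod M) → ℝ}
    (hd : 2 ≤ d) (hMord : 1 ≤ Mord) (hMR : Mord ≤ R) (hLodd : Odd L) (hL : 2 ^ (d + 3) + 16 * R ≤ L)
    (hθbar : 0 < θbar) (hlam : 0 < lam)
    (hB : AbkmWeightBounds L N Mord R n θbar lam μ δ₁ δ₀ A𝒫 𝒞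
      (abkmWeightData L N Mord R θbar (schedDelta δ₀ δ₁ N) 𝒞))
    (hn : 2 * Mord ≤ n) {Cα : (Fin d → ℕ) → ℝ}
    (hCα : ∀ j, 1 ≤ j → j ≤ N + 1 → ∀ θ' : Fin d → ℕ, ∑ i, θ' i ≤ n →
      ∀ x, |GradientFRD.iterDiff θ' (𝒞 j) x| ≤ Cα θ' / (L : ℝ) ^ ((j - 1) * (d - 2 + ∑ i, θ' i)))
    {k : ℕ} (hk : k + 1 ≤ N + 1) {ρ : ℝ} (hρ0 : 0 ≤ ρ) (hρ : ρ < θbar)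
    {𝒞q : (Fin d → ZMod M) → ℝ} (hqeven : ∀ x, 𝒞q (-x) = 𝒞q x)
    (hq_nonneg : ∀ κ, 0 ≤ (fourierCoeff 𝒞q κ).re) {p : ℝ} (hp : 0 ≤ p)
    (hq_le : ∀ κ, p * (fourierCoeff 𝒞q κ).re ≤ (1 + ρ) * cExt N (fun j => fourierCoeff (𝒞 j) κ) (k + 1))
    {C₂ : ℝ} (hγ : ∀ q : quadIndex d, ((L ^ (d * k) : ℕ) : ℝ) * |gradCov 𝒞q q| ≤ C₂) :
    StepKernelBounds (abkmWeightData L N Mord R θbar (schedDelta δ₀ δ₁ N) 𝒞) L k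
      (weightIntConstRho θbar ρ (traceConst d Mord R lam (derivSum d n fun θ' _ => Cα θ'))) (p * C₂)
      (fun x => p * 𝒞q x) := by
  refine AbkmWeightBounds.stepKernelBounds_of_multipliers_le hd hMord hMR hLodd hL hθbar hlam hB hn hCα
    hk hρ0 hρ (fun x => by simp only [hqeven]) (fun κ => ?_) (fun κ => ?_) (fun q => ?_)
  · rw [re_fourierCoeff_const_mul]; exact mul_nonneg hp (hq_nonneg κ)
  · rw [re_fourierCoeff_const_mul]; exact hq_le κ
  · rw [gradCov_const_mul, abs_mul, abs_of_nonneg hp, mul_left_comm]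
    exact mul_le_mul_of_nonneg_left (hγ q) hp

/-! ## The torus-FRD multipliers: strict positivity and two-sided closeness -/

/-- **`Re 𝒞̂_{A,k}(κ) > 0` for `κ ≠ 0`** from clause (v) (positive lower shell bounds; every nonzero
mode lies in some shell), `1 ≤ k ≤ N+1`, `L ≥ 2`, `c > 0`. [cite: Buchholz2016, Thm 2.4] -/
theorem re_fourierCoeff_pos_of_torusFRD
    {𝒞A : Matrix (Fin d) (Fin d) ℝ → ℕ → (Fin d → ZMod M) → ℝ} {c C : ℝ} {Cℓ : ℕ → ℝ}
    {L N n ñ : ℕ} {A : Matrix (Fin d) (Fin d) ℝ}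
    (hv : ∀ k, 1 ≤ k → k ≤ N + 1 → ∀ j : ℕ, ∀ κ : Fin d → ZMod M, κ ≠ 0 → InShell L j κ →
        (j < k →
          c / (L : ℝ) ^ (2 * (d + ñ) + 1) * (L : ℝ) ^ (2 * j)
              / (L : ℝ) ^ ((k - j) * (d - 1 + n)) ≤ (fourierCoeff (𝒞A A k) κ).re ∧
          ‖fourierCoeff (𝒞A A k) κ‖
            ≤ C * (L : ℝ) ^ (2 * (d + ñ) + 1) * (L : ℝ) ^ (2 * j)
                / (L : ℝ) ^ ((k - j) * (d - 1 + n))) ∧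
        (k ≤ j →
          c / (L : ℝ) ^ (2 * (d + ñ) + 1) * (L : ℝ) ^ (2 * k)
              ≤ (fourierCoeff (𝒞A A k) κ).re ∧
          ‖fourierCoeff (𝒞A A k) κ‖ ≤ C * (L : ℝ) ^ (2 * k)) ∧
        ∀ B : Matrix (Fin d) (Fin d) ℝ, IsUnitSymm B → ∀ ℓ : ℕ, 1 ≤ ℓ →
          (j < k →
            ‖iteratedDeriv ℓ (fun s : ℝ => fourierCoeff (𝒞A (A + s • B) k) κ) 0‖
              ≤ Cℓ ℓ * (L : ℝ) ^ (2 * (d + ñ) + 1) * (L : ℝ) ^ (2 * j)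
                  / (L : ℝ) ^ ((k - j) * (d - 1 + ñ))) ∧
          (k ≤ j →
            ‖iteratedDeriv ℓ (fun s : ℝ => fourierCoeff (𝒞A (A + s • B) k) κ) 0‖
              ≤ Cℓ ℓ * (L : ℝ) ^ (2 * k)))
    (hc : 0 < c) (hL : 2 ≤ L) {k : ℕ} (hk1 : 1 ≤ k) (hkN : k ≤ N + 1) {κ : Fin d → ZMod M}
    (hκ : κ ≠ 0) : 0 < (fourierCoeff (𝒞A A k) κ).re := by
  obtain ⟨j, hj⟩ := exists_inShell hL hκ
  have hL0 : (0 : ℝ) < L := by exact_mod_cast (show 0 < L by omega)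
  rcases lt_or_ge j k with hjk | hkj
  · exact lt_of_lt_of_le (by positivity) (((hv k hk1 hkN j κ hκ hj).1 hjk).1)
  · exact lt_of_lt_of_le (by positivity) (((hv k hk1 hkN j κ hκ hj).2.1 hkj).1)

omit [NeZero M] in
/-- `−B` is a unit symmetric direction when `B` is. [cite: Buchholz2016, Thm 2.4] -/
theorem isUnitSymm_neg {B : Matrix (Fin d) (Fin d) ℝ} (hB : IsUnitSymm B) : IsUnitSymm (-B) := by
  refine ⟨hB.1.neg, fun z => ?_⟩
  have h : ∑ i, ∑ j, z i * (-B) i j * z j = -∑ i, ∑ j, z i * B i j * z j := by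
    simp only [Matrix.neg_apply, mul_neg, neg_mul, Finset.sum_neg_distrib]
  rw [h, abs_neg]
  exact hB.2 z

/-- **Two-sided closeness of the multipliers along an elliptic segment** ([ABKM19] (7.75) in both
directions): for a package with clauses (o), (iv), (v) (for every elliptic `A`), `B` unit symmetric,
the segment `A₀ + tB`, `t ∈ [0,T]`, elliptic, `1 ≤ k ≤ N+1`, `τ ≥ 0` and
`shellRatioConst c (Cℓ 1) L d ñ · T ≤ log (1+τ)`:
`|Re 𝒞̂_{A₀+TB,k}(κ) − Re 𝒞̂_{A₀,k}(κ)| ≤ τ(1+τ) · Re 𝒞̂_{A₀+TB,k}(κ)` for every `κ`.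
[cite: AdamsBuchholzKoteckyMuller2019, Lemma 7.7 (7.75)] -/
theorem abs_re_fourierCoeff_sub_le_of_torusFRD
    {𝒞A : Matrix (Fin d) (Fin d) ℝ → ℕ → (Fin d → ZMod M) → ℝ} {ω₀ Ω₀ c C : ℝ} {Cℓ : ℕ → ℝ}
    {Cα : (Fin d → ℕ) → ℕ → ℝ} {L N n ñ : ℕ}
    (ho : ∀ A : Matrix (Fin d) (Fin d) ℝ, IsElliptic ω₀ Ω₀ A →
      ∀ k, 1 ≤ k → k ≤ N + 1 → ∑ x : Fin d → ZMod M, 𝒞A A k x = 0 ∧ ∀ x, 𝒞A A k (-x) = 𝒞A A k x)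
    (hiv : ∀ A : Matrix (Fin d) (Fin d) ℝ, IsElliptic ω₀ Ω₀ A →
      ∀ k, 1 ≤ k → k ≤ N + 1 → ∀ B : Matrix (Fin d) (Fin d) ℝ, IsUnitSymm B →
        (∃ ε : ℝ, 0 < ε ∧ ∀ x : Fin d → ZMod M,
          ContDiffOn ℝ ⊤ (fun s : ℝ => 𝒞A (A + s • B) k x) (Set.Ioo (-ε) ε)) ∧
        ∀ α : Fin d → ℕ, ∑ i, α i ≤ n → ∀ ℓ : ℕ, ∀ x : Fin d → ZMod M,
          abs (iteratedDeriv ℓ (fun s : ℝ => GradientFRD.iterDiff α (𝒞A (A + s • B) k) x) 0)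
            ≤ Cα α ℓ / (L : ℝ) ^ ((k - 1) * (d - 2 + ∑ i, α i)))
    (hv : ∀ A : Matrix (Fin d) (Fin d) ℝ, IsElliptic ω₀ Ω₀ A →
      ∀ k, 1 ≤ k → k ≤ N + 1 → ∀ j : ℕ, ∀ κ : Fin d → ZMod M, κ ≠ 0 → InShell L j κ →
        (j < k →
          c / (L : ℝ) ^ (2 * (d + ñ) + 1) * (L : ℝ) ^ (2 * j)
              / (L : ℝ) ^ ((k - j) * (d - 1 + n)) ≤ (fourierCoeff (𝒞A A k) κ).re ∧
          ‖fourierCoeff (𝒞A A k) κ‖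
            ≤ C * (L : ℝ) ^ (2 * (d + ñ) + 1) * (L : ℝ) ^ (2 * j)
                / (L : ℝ) ^ ((k - j) * (d - 1 + n))) ∧
        (k ≤ j →
          c / (L : ℝ) ^ (2 * (d + ñ) + 1) * (L : ℝ) ^ (2 * k)
              ≤ (fourierCoeff (𝒞A A k) κ).re ∧
          ‖fourierCoeff (𝒞A A k) κ‖ ≤ C * (L : ℝ) ^ (2 * k)) ∧
        ∀ B : Matrix (Fin d) (Fin d) ℝ, IsUnitSymm B → ∀ ℓ : ℕ, 1 ≤ ℓ →
          (j < k →
            ‖iteratedDeriv ℓ (fun s : ℝ => fourierCoeff (𝒞A (A + s • B) k) κ) 0‖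
              ≤ Cℓ ℓ * (L : ℝ) ^ (2 * (d + ñ) + 1) * (L : ℝ) ^ (2 * j)
                  / (L : ℝ) ^ ((k - j) * (d - 1 + ñ))) ∧
          (k ≤ j →
            ‖iteratedDeriv ℓ (fun s : ℝ => fourierCoeff (𝒞A (A + s • B) k) κ) 0‖
              ≤ Cℓ ℓ * (L : ℝ) ^ (2 * k)))
    (hc : 0 < c) (hC1 : 0 ≤ Cℓ 1) (hL : 2 ≤ L) (hn : n ≤ ñ)
    {A₀ B : Matrix (Fin d) (Fin d) ℝ} (hB : IsUnitSymm B) {T : ℝ} (hT : 0 ≤ T)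
    (hell : ∀ t ∈ Icc 0 T, IsElliptic ω₀ Ω₀ (A₀ + t • B))
    {k : ℕ} (hk1 : 1 ≤ k) (hkN : k ≤ N + 1) {τ : ℝ} (hτ : 0 ≤ τ)
    (hKT : shellRatioConst c (Cℓ 1) (L : ℝ) d ñ * T ≤ Real.log (1 + τ)) (κ : Fin d → ZMod M) :
    |(fourierCoeff (𝒞A (A₀ + T • B) k) κ).re - (fourierCoeff (𝒞A A₀ k) κ).re| ≤
      τ * (1 + τ) * (fourierCoeff (𝒞A (A₀ + T • B) k) κ).re := by
  have hell0 : IsElliptic ω₀ Ω₀ A₀ := by simpa using hell 0 ⟨le_rfl, hT⟩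
  have hellT : IsElliptic ω₀ Ω₀ (A₀ + T • B) := hell T ⟨hT, le_rfl⟩
  by_cases hκ : κ = 0
  · subst hκ
    rw [re_fourierCoeff_zero_of_sum_eq_zero (ho _ hellT k hk1 hkN).1,
      re_fourierCoeff_zero_of_sum_eq_zero (ho _ hell0 k hk1 hkN).1, sub_self, abs_zero, mul_zero]
  obtain ⟨j, hj⟩ := exists_inShell hL hκ
  -- forward: `Re 𝒞̂_{A₀+TB} ≤ (1+τ) Re 𝒞̂_{A₀}`
  have hfwd := re_fourierCoeff_le_one_add_mul_of_torusFRD hiv hv hc hC1 (by omega) hn hB hT hell hk1 hkN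
    hκ hj (by linarith) hKT
  -- backward along the reversed segment `(A₀ + TB) + t(−B)`
  have hell' : ∀ t ∈ Icc 0 T, IsElliptic ω₀ Ω₀ (A₀ + T • B + t • (-B)) := by
    intro t ht
    have hmem : T - t ∈ Icc 0 T := ⟨by linarith [ht.2], by linarith [ht.1]⟩
    have := hell (T - t) hmem
    convert this using 1
    rw [sub_smul, smul_neg, add_assoc, ← sub_eq_add_neg]
  have hbwd := re_fourierCoeff_le_one_add_mul_of_torusFRD hiv hv hc hC1 (by omega) hn (isUnitSymm_neg hB)
    hT hell' hk1 hkN hκ hj (by linarith) hKT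
  have hend : A₀ + T • B + T • (-B) = A₀ := by rw [smul_neg, add_neg_cancel_right]
  rw [hend] at hbwd
  have hpos : 0 ≤ (fourierCoeff (𝒞A (A₀ + T • B) k) κ).re :=
    (re_fourierCoeff_pos_of_torusFRD (hv _ hellT) hc hL hk1 hkN hκ).le
  exact abs_sub_le_of_two_sided hτ hpos hbwd hfwd

/-! ## The estimate for the concrete norm parameters -/

/-- The gauge of the concrete norms kills the constants.
[cite: AdamsBuchholzKoteckyMuller2019, Ch. 6.4 (N_k contains the constants)] -/
theorem gauge_const (P : NormParams d M) (k : ℕ) (X : Finset (Fin d → ZMod M)) (a : ℝ) :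
    P.gauge k X (fun _ : Fin d → ZMod M => a) = 0 :=
  fieldGauge_const _ _ _ _ a

/-- **[ABKM19] Lemma 8.4 (`ℓ = 1`, crude volume-dependent form) for the torus norm parameters**:
for the weight tower of Theorem 7.1 (`AbkmWeightBounds`), two even zero-sum step kernels `𝒞a, 𝒞b`
with `StepKernelBounds` at scale `k`, positive multipliers off the zero mode and
`|Re 𝒞̂a − Re 𝒞̂b| ≤ δ · Re 𝒞̂a`, Hölder conjugates `p, q` with `δ ≤ 1/(16q)` and `StepKernelBounds`
for `p·𝒞b` (constant `A𝒫p`), a `k`-polymer `X` and a `T_k^{X*}`-local `C^{r₀}` functional `K` with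
`‖K‖_{k,X} ≤ C`:
`‖fluct 𝒞a K − fluct 𝒞b K‖_{k:k+1,X} ≤ C · ((r₀+1) · gaussCompConst(|Λ|, q) · δ · (A𝒫p^{|X|_k})^{1/p})`.
[cite: AdamsBuchholzKoteckyMuller2019, Lemma 8.4] -/
theorem tayNormLE_fluct_sub_fluct_abkm {L N Mord R n pT r₀ : ℕ}
    {θbar lam μ δ₁ δ₀ A𝒫 A𝒫a A𝒫b A𝒫p C₂a C₂b C₂p h A : ℝ} {𝒞 : ℕ → (Fin d → ZMod M) → ℝ}
    {𝒞a 𝒞b : (Fin d → ZMod M) → ℝ}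
    (hB : AbkmWeightBounds L N Mord R n θbar lam μ δ₁ δ₀ A𝒫 𝒞
      (abkmWeightData L N Mord R θbar (schedDelta δ₀ δ₁ N) 𝒞))
    {k : ℕ}
    (hSa : StepKernelBounds (abkmWeightData L N Mord R θbar (schedDelta δ₀ δ₁ N) 𝒞) L k A𝒫a C₂a 𝒞a)
    (hSb : StepKernelBounds (abkmWeightData L N Mord R θbar (schedDelta δ₀ δ₁ N) 𝒞) L k A𝒫b C₂b 𝒞b)
    {p q : ℝ} (hpq : p.HolderConjugate q)
    (hSp : StepKernelBounds (abkmWeightData L N Mord R θbar (schedDelta δ₀ δ₁ N) 𝒞) L k A𝒫p C₂p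
      (fun x => p * 𝒞b x))
    (hea : ∀ x, 𝒞a (-x) = 𝒞a x) (heb : ∀ x, 𝒞b (-x) = 𝒞b x)
    (h0a : ∑ x, 𝒞a x = 0) (h0b : ∑ x, 𝒞b x = 0)
    (hposa : ∀ κ, κ ≠ 0 → 0 < (fourierCoeff 𝒞a κ).re)
    (hposb : ∀ κ, κ ≠ 0 → 0 < (fourierCoeff 𝒞b κ).re)
    {δ : ℝ} (hδ0 : 0 ≤ δ) (hδq : δ ≤ 1 / (16 * q))
    (hcmp : ∀ κ, |(fourierCoeff 𝒞a κ).re - (fourierCoeff 𝒞b κ).re| ≤ δ * (fourierCoeff 𝒞a κ).re)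
    {X : Finset (Fin d → ZMod M)} (hX : IsPolymer (L ^ k) X)
    {K : ((Fin d → ZMod M) → ℝ) → ℂ} {C : ℝ} (hC : 0 ≤ C) (hKd : ContDiff ℝ r₀ K)
    (hKloc : IsGaugeLocal ((abkmNormParams L N Mord R pT r₀ h θbar A (schedDelta δ₀ δ₁ N) 𝒞).gauge k X) K)
    (hK : TayNormLE ((abkmNormParams L N Mord R pT r₀ h θbar A (schedDelta δ₀ δ₁ N) 𝒞).gauge k X) r₀
      ((abkmWeightData L N Mord R θbar (schedDelta δ₀ δ₁ N) 𝒞).weight k X) K C) :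
    TayNormLE ((abkmNormParams L N Mord R pT r₀ h θbar A (schedDelta δ₀ δ₁ N) 𝒞).gauge k X) r₀
      ((abkmWeightData L N Mord R θbar (schedDelta δ₀ δ₁ N) 𝒞).midWeight k X) (fluct 𝒞a K - fluct 𝒞b K)
      (C * ((r₀ + 1) * gaussCompConst (Fintype.card (Fin d → ZMod M)) q * δ *
        (A𝒫p ^ numBlocks (L ^ k) X) ^ (1 / p))) :=
  tayNormLE_fluct_sub_fluct _ hB.isLocal hB.dominated hSa hSb hpq hSp hea heb h0a h0b hposa hposb hδ0
    hδq hcmp hX _ (gauge_const _ k X) hC hKd hKloc hK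

end Literature.MathematicalPhysics.StatisticalMechanics.GradientRG

end
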